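import Summits.CriticalPhenomena.PercolationContinuityZ3.Theorems.PercNearOneGluingNoHeavyQuantLightSiblingCore
import HarnessLib

/-!
# QUANT lane R8, T-DEC: COMP-SLICE AT THE TRIVIAL GATE — a light piece `{lo, lo+K; γ}` (any gate `γ`, below the floor allowed) convolved with an SDEC law is
# DEC at every layer, by the shift lemma's double-target bonus (arm-1 gen 56, architect)

builds on p205010 (kernel theorem, internal audit signed; external expert review pending)

Support file (`--supports stmt-CriticalPhenomena-4575`), QUANT lane seat prim-quant-arm-1 (gen 56, architect); memo
`run/shared/lean/prim/quant/prim-quant-arm-1-g56/ARCH-G56.md` §4.  Theorems only; standard axioms, no sorries.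

COMP-SLICE (memo §4; the one lemma between the tree and "the sibling step owes only all-heavy-unfloored forests") asks that `{lo, lo+K; γ} ∗ β` be SDEC at `x`
for `β` SDEC and affordable at `x` and a LIGHT piece (`Kγ ≤ lo`).  This file proves its UNGATED layer (`q = 1` of the SDEC quantifier):
**`decAt_all_lightPiece_ungated`** — `{lo, lo+K; γ} ∗ β` is DEC at floor `x` at EVERY layer below its top.  Proof: `{lo, lo+K; γ} ∗ β = (1−γ)·S_lo β + γ·S_{lo+K} β`
(shifted copies); by the shift lemma with the double target bonus (`decAtT_shift_two`, this lane) `S_s β` is DEC at target `S + 2s` at layer `j` from `β`'s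
decomposition at layer `j − s` (layers `j < s`: every atom is a giant, `decAtT_of_atoms_above`); the common target `S + lo + Kγ ≤ S + 2·lo` is reached by
antitonicity (`Kγ ≤ lo` is exactly what is used) and the two copies are mixed at it (`decAtT_mixture`).  The gated layers (`q < 1`) are the open part: there the
gate's zero atom must be re-paired across the two copies (memo §4: the copy-by-copy route is false, explore/sg_probe.py).

* `decAtT_of_atoms_above` (a law with no atom at or below the layer is DEC at any target), `shift_eq_lconv_point` (`S_s β = δ_s ∗ β` pointwise),
  `decAtT_shift_of_sdec` (the shifted copy at target `S + 2s`, every layer), **`decAt_all_lightPiece_ungated`**.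

HONEST STATUS.  Partial result toward COMP-SLICE (ungated layer only); `SiblingStep` / `GateStepN` / `LightResidDECOracle` / `FarTreeRow` OPEN; RATE class (log\*) /
honest sentence of `run/shared/lean/prim/quant/README.md` unchanged.  [this work].  Nothing here is cited as a published result.  The gluing rows served
[cite: KozmaNitzan2024, Conjecture 3 (p. 15)]; product measure [cite: Grimmett1999, §1.3 p. 10].
-/

noncomputable section

open scoped BigOperators

namespace Summit.CriticalPhenomena.PercolationContinuityZ3.Theorems
namespace Quant

open Finset

/-- the two-point law `{lo, hi; g}` (as in `…QuantLawDEC`) -/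
local notation3 "TP[" lo ", " hi ", " g ", " h "]" =>
  (g : ℝ) * (if (h : ℕ) = (hi : ℕ) then (1 : ℝ) else 0) + (1 - (g : ℝ)) * (if (h : ℕ) = (lo : ℕ) then (1 : ℝ) else 0)

namespace LawDec

/-- the point mass `δ_K` -/
local notation3 "δ[" K "]" => (fun k : ℕ => if k = (K : ℕ) then (1 : ℝ) else 0)

/-- the two-point law `{lo, lo+K; g}` = `lo` sure relays and a blob of size `K` at gate `g` -/
local notation3 "TPL[" lo ", " K ", " g "]" => lconv lo K δ[lo] (gate δ[K] g)

/-- **a law with no atom at or below the layer is DEC at any target**: every charged atom `h ≥ j′+1` is a self-sufficient point mass. [this work] -/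
theorem decAtT_of_atoms_above (y T : ℝ) (j' M : ℕ) (ν : ℕ → ℝ) (hν0 : ∀ h, 0 ≤ ν h) (hνM : ∀ h, M < h → ν h = 0)
    (hν1 : ∑ h ∈ Finset.range (M + 1), ν h = 1) (hlow : ∀ h, h ≤ j' → ν h = 0) : DECAtT y T j' M ν := by
  classical
  refine ⟨Fin (M + 1), inferInstance, fun r => ν r, fun _ => 1, fun r => (r : ℕ), fun r => (r : ℕ), fun r => hν0 r,
    by rw [Fin.sum_univ_eq_sum_range (fun i => ν i) (M + 1), hν1], fun _ => ⟨zero_le_one, le_rfl⟩, fun _ => le_rfl,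
    fun r => Nat.lt_succ_iff.1 r.isLt, fun h => ?_, fun r hr => ?_⟩
  · -- the mixture identity: `ν h = Σ_r ν r · [h = r]`
    have e : ∀ r : Fin (M + 1), ν r * TP[(r : ℕ), (r : ℕ), (1 : ℝ), h] = (fun i : ℕ => if h = i then ν h else 0) r := by
      intro r
      by_cases h1 : h = (r : ℕ)
      · simp [h1]
      · simp [h1]
    rw [Finset.sum_congr rfl fun r _ => e r, Fin.sum_univ_eq_sum_range (fun i : ℕ => if h = i then ν h else 0) (M + 1)]
    simp only [Finset.sum_ite_eq, Finset.mem_range]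
    split_ifs with hm
    · rfl
    · exact hνM h (by omega)
  · have hr' : ¬ ((r : ℕ) ≤ j') := fun hle => (ne_of_gt hr) (hlow r hle)
    exact Or.inl ⟨rfl, Or.inr (by push_cast; exact_mod_cast (show j' + 1 ≤ (r : ℕ) by omega))⟩

/-- **the shifted copy** `δ_s ∗ β` pointwise: `lconv N B δ_s β h = [s ≤ h]·β(h − s)` (`s ≤ N`, `β` vanishing above `B`). [this work] -/
theorem lconv_point_left_apply (N B s : ℕ) (β : ℕ → ℝ) (hβM : ∀ h, B < h → β h = 0) (hsN : s ≤ N) (h : ℕ) :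
    lconv N B δ[s] β h = if s ≤ h then β (h - s) else 0 := by
  rw [lconv_comm, lconv_top_right_of_le B s N β _ hsN (fun k hk => if_neg (by omega)) h]
  have e2 : lconv B s β δ[s] = lconv B s β (gate δ[s] 1) := by rw [gate_one]
  rw [e2, congrFun (lconv_gate_point_eq_slice B s β 1 hβM) h]
  simp only [slice, sub_self, zero_mul, zero_add, one_mul]

/-- **THE SHIFTED COPY OF AN SDEC LAW IS DEC AT THE DOUBLY RAISED TARGET, EVERY LAYER**: `β` a probability law on `{0..B}`, affordable and SDEC at `0 < x < 1`,
mean `S`; then `δ_s ∗ β` (left top `N ≥ s`, declared on `{0..M′}`, `N + B ≤ M′`) is `DECAtT x (S + 2s) j M′` for EVERY `j` — layers `j ≥ s` by the shift lemma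
`decAtT_shift_two` from `β` at layer `j − s` (Theorem A above `B`), layers `j < s` because every atom is a giant. [this work] -/
theorem decAtT_shift_of_sdec {x : ℝ} {B : ℕ} {β : ℕ → ℝ} (hx0 : 0 < x) (hx1 : x < 1) (β0 : ∀ h, 0 ≤ β h) (βM : ∀ h, B < h → β h = 0)
    (β1 : ∑ h ∈ Finset.range (B + 1), β h = 1) (hta : x * (B : ℝ) ≤ ∑ h ∈ Finset.range (B + 1), (h : ℝ) * β h) (hS : SDEC x B β)
    (s N M' : ℕ) (hsN : s ≤ N) (hM : N + B ≤ M') (j : ℕ) :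
    DECAtT x (∑ h ∈ Finset.range (B + 1), (h : ℝ) * β h + 2 * (s : ℝ)) j M' (lconv N B δ[s] β) := by
  have e : ∀ h, (if s ≤ h then β (h - s) else 0) = lconv N B δ[s] β h := fun h => (lconv_point_left_apply N B s β βM hsN h).symm
  refine decAtT_congr (fun h => e h) ?_
  by_cases hjs : j < s
  · -- every atom of the shifted copy is `≥ s ≥ j+1`
    have v0 : ∀ h, 0 ≤ (if s ≤ h then β (h - s) else 0) := fun h => by split_ifs; exacts [β0 _, le_rfl]
    have vM : ∀ h, M' < h → (if s ≤ h then β (h - s) else 0) = 0 := fun h hh => by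
      split_ifs
      · exact βM _ (by omega)
      · rfl
    have hδ1 : ∑ h ∈ Finset.range (N + 1), (δ[s]) h = 1 := by
      rw [Finset.sum_ite_eq', if_pos (Finset.mem_range.2 (by omega))]
    have v1 : ∑ h ∈ Finset.range (M' + 1), (if s ≤ h then β (h - s) else 0) = 1 := by
      rw [Finset.sum_congr rfl fun h _ => e h, sum_range_top_mono (N + B) M' hM _ (fun h hh => lconv_eq_zero _ _ _ _ h hh)]
      exact sum_lconv _ _ _ _ hδ1 β1
    exact decAtT_of_atoms_above x _ j M' _ v0 vM v1 (fun h hh => if_neg (by omega))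
  · -- `j ≥ s`: shift `β`'s decomposition at layer `j − s`
    obtain ⟨j₀, rfl⟩ : ∃ j₀, j = j₀ + s := ⟨j - s, by omega⟩
    have d : DECAtT x (∑ h ∈ Finset.range (B + 1), (h : ℝ) * β h) j₀ B β := by
      by_cases hjB : j₀ < B
      · have d1 := hS 1 one_pos le_rfl j₀ hjB
        rw [gate_one, one_mul] at d1
        exact d1
      · refine decAt_of_top_le B β β0 βM β1 x hx1 (fun h hh => ?_) j₀ (not_lt.1 hjB)
        have hhB : h ≤ B := by
          by_contra hlt; exact (lt_irrefl (0 : ℝ)) (by rw [βM h (not_le.1 hlt)] at hh; exact hh)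
        have : x * (h : ℝ) ≤ x * B := mul_le_mul_of_nonneg_left (by exact_mod_cast hhB) hx0.le
        linarith
    exact decAtT_mono_top (decAtT_shift_two x _ j₀ B s β d) (by omega)

/-- **COMP-SLICE AT THE TRIVIAL GATE.**  `β` a probability law on `{0..B}`, affordable and SDEC at `0 < x < 1`; a piece `{lo, lo+K; γ}` with `0 ≤ γ ≤ 1` (ANY gate,
below the floor allowed) which is LIGHT (`Kγ ≤ lo`): then `{lo, lo+K; γ} ∗ β` is DEC at floor `x` at every layer below its top — the two shifted copies
`δ_lo ∗ β`, `δ_{lo+K} ∗ β` are DEC at targets `S + 2lo`, `S + 2(lo+K)` ≥ the mean `S + lo + Kγ` (`decAtT_shift_of_sdec`, antitonicity), and mix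
(`decAtT_mixture`). [this work] -/
theorem decAt_all_lightPiece_ungated {x γ : ℝ} {B lo K : ℕ} {β : ℕ → ℝ} (hx0 : 0 < x) (hx1 : x < 1) (hγ0 : 0 ≤ γ) (hγ1 : γ ≤ 1)
    (hlight : (K : ℝ) * γ ≤ lo) (β0 : ∀ h, 0 ≤ β h) (βM : ∀ h, B < h → β h = 0) (β1 : ∑ h ∈ Finset.range (B + 1), β h = 1)
    (hta : x * (B : ℝ) ≤ ∑ h ∈ Finset.range (B + 1), (h : ℝ) * β h) (hS : SDEC x B β) :
    ∀ j, j < lo + K + B → DECAt x j (lo + K + B) (lconv (lo + K) B (TPL[lo, K, γ]) β) := by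
  intro j _
  obtain ⟨_, _, p1, pmn, _⟩ := hs_facts lo K γ hγ0 hγ1
  rw [decAt_iff_decAtT, sum_mul_lconv _ _ _ _ p1 β1, pmn]
  -- the piece as a mixture of two point masses, the law as a mixture of two shifted copies
  have eP : (TPL[lo, K, γ]) = fun k => γ * (δ[lo + K]) k + (1 - γ) * (δ[lo]) k := funext fun k => tpLaw_apply lo K γ k
  have eL : lconv (lo + K) B (TPL[lo, K, γ]) β = fun h => γ * lconv (lo + K) B δ[lo + K] β h + (1 - γ) * lconv (lo + K) B δ[lo] β h := by
    funext h; rw [eP, lconv_lin_left]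
  rw [eL]
  have K0 : (0 : ℝ) ≤ K := Nat.cast_nonneg K
  refine decAtT_mixture γ hγ0 hγ1 ?_ ?_
  · refine decAtT_antitone_target ?_ (decAtT_shift_of_sdec hx0 hx1 β0 βM β1 hta hS (lo + K) (lo + K) (lo + K + B) le_rfl le_rfl j)
    push_cast; nlinarith
  · refine decAtT_antitone_target ?_ (decAtT_shift_of_sdec hx0 hx1 β0 βM β1 hta hS lo (lo + K) (lo + K + B) (by omega) le_rfl j)
    linarith

end LawDec
end Quant
end Summit.CriticalPhenomena.PercolationContinuityZ3.Theorems
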